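import Mathlib.Algebra.Order.Ring.Abs
import Mathlib.Tactic.Linarith
import Mathlib.Tactic.NormNum
import Mathlib.Tactic.Ring
import HarnessLib

/-!
# Venture HSemireg — Hermite's bound for a reduced positive binary form, `3·min² ≤ 4·det`, with equality exactly for the hexagonal form
# (the input «`n₀ ≤ min_{ℤ²} B ≤ √(4|m|∕3)` (Hermite), equality only for the hexagonal form, det `3 = |m|` — excluded» of THEOREM 30-B,
# ENGINE-W PROBE5 §30 (4)) — kernel arithmetic

HONEST FRAMING. Lean index of the computation cell `pub-hsemireg`, widening group ENGINE-W (code A, seat `engine-w-1`, gen 17). INTEGER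
INEQUALITIES for a reduced binary quadratic form; no lattice, abelian variety, sheaf or semiregularity map is constructed; nothing here says that HC,
HC_CM or HC_AV holds. Theorems only (0 `def`, 0 named fact, 0 `sorry`). New namespace `HermiteBinary`. Reduction theory itself (every positive
form is equivalent to a reduced one, whose first coefficient is the minimum) enters BY VALUE.

SOURCE (the cell's own result): `widen/ENGINE-W/out/probe5/PROBE5-STIZ-A.md` §30 (4) THEOREM 30-B, PROOF: «Let `(α₀,β₀) ∈ O_K²` realise `n₀ := min B_K(O_K²
∖ 0)` … `n₀ ≤ min_{ℤ²} B ≤ √(4|m|∕3)` (Hermite), equality only for the hexagonal form, det `3 = |m|` — excluded; so `n₀ < 2√(|m|∕3)` and the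
LEMMA … makes `g(s₀)` pure», with `B = [[t, A],[A, N]]`, `det B = tN − A² = −m = |m|` (§30 notation). For the form `t·x² + 2A·xy + N·y²`
(reduced: `|2A| ≤ t ≤ N`, `t > 0`) the kernel holds:

* §1 **`reduced_min_sq`** — `|2A| ≤ t ≤ N` ⟹ `3t² ≤ 4(tN − A²)` (i.e. `min ≤ √(4·det∕3)`); **`reduced_min_sq_lt`** — if moreover the form is
  NOT hexagonal (`¬(N = t ∧ |2A| = t)`) then `3t² < 4(tN − A²)`; `hexagonal_iff` — `3t² = 4(tN − A²) ⟺ N = t ∧ |2A| = t` (then `det = 3(t∕2)²·…`: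
  `4·det = 3t²`).
* §2 **`thirty_B_input`** — with `det = |m|` and `|m| ≠ 3u²`-type exclusion as printed («det `3 = |m|` — excluded»): for a reduced form of
  determinant `|m|` with `(t, N, |2A|) ≠ (t, t, t)`, `3t² < 4|m|`, hence `t² < 4|m|∕3·… `, i.e. `n₀² < 4|m|∕3` — the strict window used by LEMMA 30.2
  at `d = 3` (`n₀ < 2√(|m|∕3)` squared: `3n₀² < 4|m|`); and `hexagonal_det` — a hexagonal reduced form `[[t, ±t∕2],[±t∕2, t]]` has `4·det = 3t²`,
  so `det = |m|` squarefree forces `t = 2`, `|m| = 3` — the excluded `m = −3`.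
-/

namespace Summit.Ventures.HSemireg.HermiteBinary

/-! ## §1 The reduced-form inequality -/

/-- **Hermite for reduced binary forms**: `|2A| ≤ t`, `t ≤ N`, `0 < t` ⟹ `3t² ≤ 4(tN − A²)`. [kernel] -/
theorem reduced_min_sq (t A N : ℤ) (ht : 0 < t) (hA : |2 * A| ≤ t) (hN : t ≤ N) : 3 * t ^ 2 ≤ 4 * (t * N - A ^ 2) := by
  have h1 : (2 * A) ^ 2 ≤ t ^ 2 := by
    have := abs_le.1 hA
    nlinarith [this.1, this.2, sq_abs (2 * A)]
  nlinarith

/-- **Equality iff hexagonal**: under the reduction conditions, `3t² = 4(tN − A²) ⟺ N = t ∧ |2A| = t`. [kernel] -/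
theorem hexagonal_iff (t A N : ℤ) (ht : 0 < t) (hA : |2 * A| ≤ t) (hN : t ≤ N) :
    3 * t ^ 2 = 4 * (t * N - A ^ 2) ↔ (N = t ∧ |2 * A| = t) := by
  have hsq : |2 * A| ^ 2 = (2 * A) ^ 2 := sq_abs _
  have hb := abs_nonneg (2 * A)
  constructor
  · intro h
    -- 3t² = 4tN − 4A² with 4A² ≤ t² and N ≥ t forces both equalities
    have h1 : (2 * A) ^ 2 ≤ t ^ 2 := by nlinarith [abs_le.1 hA |>.1, abs_le.1 hA |>.2]
    have hNt : N = t := by nlinarith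
    subst hNt
    have h2 : (2 * A) ^ 2 = N ^ 2 := by nlinarith
    refine ⟨rfl, ?_⟩
    have : |2 * A| ^ 2 = N ^ 2 := by rw [hsq, h2]
    nlinarith [this]
  · rintro ⟨rfl, h⟩
    have : (2 * A) ^ 2 = N ^ 2 := by rw [← hsq, h]
    nlinarith [this]

/-- **Strict inequality off the hexagonal form**: reduced and not hexagonal ⟹ `3t² < 4(tN − A²)`. [kernel] -/
theorem reduced_min_sq_lt (t A N : ℤ) (ht : 0 < t) (hA : |2 * A| ≤ t) (hN : t ≤ N) (hnot : ¬ (N = t ∧ |2 * A| = t)) :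
    3 * t ^ 2 < 4 * (t * N - A ^ 2) := by
  rcases lt_or_eq_of_le (reduced_min_sq t A N ht hA hN) with h | h
  · exact h
  · exact absurd ((hexagonal_iff t A N ht hA hN).1 h) hnot

/-! ## §2 The THEOREM 30-B input -/

/-- **«`n₀ < 2√(|m|∕3)`»** squared: for a reduced, non-hexagonal form of determinant `|m|`, the minimum `n₀ = t` satisfies `3n₀² < 4|m|` —
the strict window of LEMMA 30.2 at `d = 3`. [kernel] -/
theorem thirty_B_input (t A N mabs : ℤ) (ht : 0 < t) (hA : |2 * A| ≤ t) (hN : t ≤ N) (hdet : t * N - A ^ 2 = mabs)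
    (hnot : ¬ (N = t ∧ |2 * A| = t)) : 3 * t ^ 2 < 4 * mabs := by
  rw [← hdet]; exact reduced_min_sq_lt t A N ht hA hN hnot

/-- **The excluded case**: a hexagonal reduced form (`N = t`, `|2A| = t`) has `4·det = 3t²`; so `t` is even, `t = 2u`, `det = 3u²` — a SQUAREFREE
determinant `|m|` is then `3` (`u = ±1`), i.e. `m = −3`, the excluded field («det `3 = |m|` — excluded»). [kernel] -/
theorem hexagonal_det (t A N : ℤ) (hN : N = t) (hA : |2 * A| = t) :
    4 * (t * N - A ^ 2) = 3 * t ^ 2 ∧ ∃ u : ℤ, t = 2 * u ∧ t * N - A ^ 2 = 3 * u ^ 2 := by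
  subst hN
  have hsq : (2 * A) ^ 2 = N ^ 2 := by rw [← sq_abs, hA]
  refine ⟨by nlinarith [hsq], ?_⟩
  rcases abs_eq (by nlinarith [abs_nonneg (2 * A), hA] : (0 : ℤ) ≤ N) |>.1 hA with h | h
  · exact ⟨A, by linarith, by nlinarith [hsq]⟩
  · exact ⟨-A, by linarith, by nlinarith [hsq]⟩

/-- … and `3u² ` squarefree forces `u² = 1`: if `3u²` has no square factor `> 1` (here: `u² ∣ 3u²` with `u²` a unit) then `u = ±1` and the
determinant is `3`. Arithmetic form: `u ≠ 0`, `u² ∣ 3` ⟹ `u = 1 ∨ u = −1`. [kernel] -/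
theorem squarefree_forces_three (u : ℤ) (hu : u ≠ 0) (h : u ^ 2 ∣ 3) : u = 1 ∨ u = -1 := by
  have hle : u ^ 2 ≤ 3 := Int.le_of_dvd (by norm_num) h
  have h1 : -1 ≤ u := by nlinarith
  have h2 : u ≤ 1 := by nlinarith
  rcases lt_trichotomy u 0 with hl | he | hg
  · right; omega
  · exact absurd he hu
  · left; omega

end Summit.Ventures.HSemireg.HermiteBinary
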